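import Mathlib
import Summits.NavierStokesRegularity.NavierStokesRegularity.Theorems.FilamentSkeletonRssClause13CutoffCommutator

/-!
# Clause 13-J/13-R, brick n3 LAYER B (PIECES, commutation): convolutions commute — `K∗(k∗Y) = k∗(K∗Y)` — and the piece of a conjugate

Route `FilamentSkeletonRss`, ∃-side clause 13 (`Clause13RNearStraightL` stmt-NavierStokesRegularity-23612; typing-agnostic); design
`filament-plan/DESIGN-28296-model-gluing-g16.md` §2 ("convolutions commute with `M_q`").  For the gluing one needs `𝓛(k∗Y) = k∗(𝓛Y) − [k∗, w]∂Y + …`,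
whose only non-formal ingredient is that the cut-off `k∗` commutes with the model self operator `M_q = (2/q)I − K_q∗`, i.e. with the convolution
by the smoothing kernel `K_q`.  This file proves, for real continuous BOUNDED integrable kernels `K, k` and a continuous compactly supported `Y`:

* §1 `integral_integral_kernel_kernel_swap` — Fubini: `∫K(x−y)(∫k(y−z)Y(z)dz)dy = ∫(∫K(x−y)k(y−z)dy)Y(z)dz`;
  `integral_kernel_kernel_shift` — `∫K(x−y)k(y−z)dy = ∫K(x−z−s)k(s)ds`; `integral_kernel_kernel_comm` — `∫K(u−s)k(s)ds = ∫k(u−s)K(s)ds`;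
* §2 `conv_conv_comm` — **`∫K(x−y)(∫k(y−z)Y(z)dz)dy = ∫k(x−y)(∫K(y−z)Y(z)dz)dy`**;
* §3 `conj_piece` — `conj ∫k(x−y)Y(y)dy = ∫k(x−y)conj Y(y)dy` (real kernel).
With `K = K_q` (bounded by `2q^{-3/2}`, `abs_smoothingKernel_le_const` p686548; integrable, `integrable_smoothingKernel` p665209) this is
`K_q∗(k∗Y) = k∗(K_q∗Y)`, hence `M_q(k∗Y) = k∗(M_qY)`.
Lane ns-filament-19175-p1 g16; `--supports stmt-NavierStokesRegularity-23612 --as helper`.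
HONEST FRAMING: harmonic-analysis bookkeeping attached to a HYPOTHETICAL filament skeleton's linearised operator on the NEGATIVE side of a MODEL route;
nothing here bears on Navier–Stokes regularity or blow-up.
-/

noncomputable section

open MeasureTheory Real Complex Filter Set
open scoped ComplexConjugate Topology

namespace Summit.NavierStokesRegularity.NavierStokesRegularity.Theorems.MatchedKernel
set_option linter.dupNamespace false

/-! ## §1 Fubini and the two substitutions -/

/-- The triple integrand `K(x−y)k(y−z)Y(z)` is integrable on `ℝ²` (in `(y, z)`) when `K ∈ L¹` is continuous, `k` is continuous and bounded, and
`Y` is continuous with compact support. [folklore] -/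
theorem integrable_kernel_kernel_prod {K k : ℝ → ℝ} (hKc : Continuous K) (hKi : Integrable K) (hkc : Continuous k) {M : ℝ}
    (hkM : ∀ t, |k t| ≤ M) {Y : ℝ → ℂ} (hYc : Continuous Y) (hYs : HasCompactSupport Y) (x : ℝ) :
    Integrable (fun p : ℝ × ℝ => ((K (x - p.1) : ℝ) : ℂ) * (((k (p.1 - p.2) : ℝ) : ℂ) * Y p.2)) (volume.prod volume) := by
  have hM : 0 ≤ M := (abs_nonneg _).trans (hkM 0)
  -- dominate by `|K(x−y)| · (M‖Y(z)‖)`, a product of integrable functions of `y` and of `z`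
  have hF : Continuous fun p : ℝ × ℝ => ((K (x - p.1) : ℝ) : ℂ) * (((k (p.1 - p.2) : ℝ) : ℂ) * Y p.2) :=
    (Complex.continuous_ofReal.comp (hKc.comp (continuous_const.sub continuous_fst))).mul
      ((Complex.continuous_ofReal.comp (hkc.comp (continuous_fst.sub continuous_snd))).mul (hYc.comp continuous_snd))
  have hdom : Integrable (fun p : ℝ × ℝ => |K (x - p.1)| * (M * ‖Y p.2‖)) (volume.prod volume) := by
    have h1 : Integrable (fun y : ℝ => |K (x - y)|) volume := by
      have := (hKi.comp_sub_left x).abs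
      exact this
    have h2 : Integrable (fun z : ℝ => M * ‖Y z‖) volume := ((hYc.integrable_of_hasCompactSupport hYs).norm).const_mul M
    exact h1.mul_prod h2
  refine hdom.mono' (hF.aestronglyMeasurable) (ae_of_all _ fun p => ?_)
  simp only [norm_mul, Complex.norm_real, Real.norm_eq_abs]
  have := hkM (p.1 - p.2)
  have hK0 : 0 ≤ |K (x - p.1)| := abs_nonneg _
  have hY0 : 0 ≤ ‖Y p.2‖ := norm_nonneg _
  calc |K (x - p.1)| * (|k (p.1 - p.2)| * ‖Y p.2‖) ≤ |K (x - p.1)| * (M * ‖Y p.2‖) := by gcongr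

/-- **Fubini**: `∫K(x−y)(∫k(y−z)Y(z)dz)dy = ∫(∫K(x−y)k(y−z)dy)Y(z)dz`. [folklore] -/
theorem integral_integral_kernel_kernel_swap {K k : ℝ → ℝ} (hKc : Continuous K) (hKi : Integrable K) (hkc : Continuous k) {M : ℝ}
    (hkM : ∀ t, |k t| ≤ M) {Y : ℝ → ℂ} (hYc : Continuous Y) (hYs : HasCompactSupport Y) (x : ℝ) :
    ∫ y : ℝ, ((K (x - y) : ℝ) : ℂ) * ∫ z : ℝ, ((k (y - z) : ℝ) : ℂ) * Y z
      = ∫ z : ℝ, (∫ y : ℝ, ((K (x - y) : ℝ) : ℂ) * ((k (y - z) : ℝ) : ℂ)) * Y z := by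
  have hI := integrable_kernel_kernel_prod hKc hKi hkc hkM hYc hYs x
  calc ∫ y : ℝ, ((K (x - y) : ℝ) : ℂ) * ∫ z : ℝ, ((k (y - z) : ℝ) : ℂ) * Y z
      = ∫ y : ℝ, ∫ z : ℝ, ((K (x - y) : ℝ) : ℂ) * (((k (y - z) : ℝ) : ℂ) * Y z) := by
        refine integral_congr_ae (ae_of_all _ fun y => ?_); simp only; rw [← integral_const_mul]
    _ = ∫ z : ℝ, ∫ y : ℝ, ((K (x - y) : ℝ) : ℂ) * (((k (y - z) : ℝ) : ℂ) * Y z) := integral_integral_swap hI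
    _ = ∫ z : ℝ, (∫ y : ℝ, ((K (x - y) : ℝ) : ℂ) * ((k (y - z) : ℝ) : ℂ)) * Y z := by
        refine integral_congr_ae (ae_of_all _ fun z => ?_); simp only
        rw [← integral_mul_const]
        refine integral_congr_ae (ae_of_all _ fun y => ?_); simp only; ring

/-- Shift: `∫K(x−y)k(y−z)dy = ∫K((x−z)−s)k(s)ds`. [folklore] -/
theorem integral_kernel_kernel_shift (K k : ℝ → ℝ) (x z : ℝ) :
    ∫ y : ℝ, ((K (x - y) : ℝ) : ℂ) * ((k (y - z) : ℝ) : ℂ) = ∫ s : ℝ, ((K (x - z - s) : ℝ) : ℂ) * ((k s : ℝ) : ℂ) := by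
  have h := integral_sub_right_eq_self (μ := (volume : Measure ℝ)) (fun y : ℝ => ((K (x - y) : ℝ) : ℂ) * ((k (y - z) : ℝ) : ℂ)) (-z)
  -- `y ↦ y - (-z) = y + z`
  rw [← h]
  refine integral_congr_ae (ae_of_all _ fun s => ?_)
  simp only [sub_neg_eq_add]
  congr 2
  · ring_nf
  · ring_nf

/-- Commutativity of the kernel–kernel convolution: `∫K(u−s)k(s)ds = ∫k(u−s)K(s)ds`. [folklore] -/
theorem integral_kernel_kernel_comm (K k : ℝ → ℝ) (u : ℝ) :
    ∫ s : ℝ, ((K (u - s) : ℝ) : ℂ) * ((k s : ℝ) : ℂ) = ∫ s : ℝ, ((k (u - s) : ℝ) : ℂ) * ((K s : ℝ) : ℂ) := by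
  have h := integral_sub_left_eq_self (μ := (volume : Measure ℝ)) (fun s : ℝ => ((K (u - s) : ℝ) : ℂ) * ((k s : ℝ) : ℂ)) u
  rw [← h]
  refine integral_congr_ae (ae_of_all _ fun s => ?_)
  simp only [sub_sub_cancel]
  ring

/-! ## §2 Convolutions commute -/

/-- **`K∗(k∗Y) = k∗(K∗Y)`** pointwise, for real continuous bounded integrable kernels `K, k` and a continuous compactly supported `Y`. [folklore] -/
theorem conv_conv_comm {K k : ℝ → ℝ} (hKc : Continuous K) (hKi : Integrable K) {MK : ℝ} (hKM : ∀ t, |K t| ≤ MK)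
    (hkc : Continuous k) (hki : Integrable k) {Mk : ℝ} (hkM : ∀ t, |k t| ≤ Mk)
    {Y : ℝ → ℂ} (hYc : Continuous Y) (hYs : HasCompactSupport Y) (x : ℝ) :
    ∫ y : ℝ, ((K (x - y) : ℝ) : ℂ) * ∫ z : ℝ, ((k (y - z) : ℝ) : ℂ) * Y z
      = ∫ y : ℝ, ((k (x - y) : ℝ) : ℂ) * ∫ z : ℝ, ((K (y - z) : ℝ) : ℂ) * Y z := by
  rw [integral_integral_kernel_kernel_swap hKc hKi hkc hkM hYc hYs x, integral_integral_kernel_kernel_swap hkc hki hKc hKM hYc hYs x]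
  refine integral_congr_ae (ae_of_all _ fun z => ?_)
  simp only
  rw [integral_kernel_kernel_shift K k x z, integral_kernel_kernel_shift k K x z, integral_kernel_kernel_comm K k (x - z)]

/-! ## §3 The piece of a conjugate -/

/-- `conj ∫k(x−y)Y(y)dy = ∫k(x−y)·conj Y(y)dy` for a real kernel. [folklore] -/
theorem conj_piece (k : ℝ → ℝ) (Y : ℝ → ℂ) (x : ℝ) :
    conj (∫ y : ℝ, ((k (x - y) : ℝ) : ℂ) * Y y) = ∫ y : ℝ, ((k (x - y) : ℝ) : ℂ) * conj (Y y) := by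
  rw [← integral_conj]
  refine integral_congr_ae (ae_of_all _ fun y => ?_)
  simp only [map_mul, Complex.conj_ofReal]

end Summit.NavierStokesRegularity.NavierStokesRegularity.Theorems.MatchedKernel

end
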